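import Mathlib.LinearAlgebra.Eigenspace.Pi
import Mathlib.LinearAlgebra.Eigenspace.Triangularizable
import Mathlib.LinearAlgebra.Dimension.Finite
import Mathlib.LinearAlgebra.Matrix.ToLin
import Mathlib.Analysis.Complex.Polynomial.Basic
import HarnessLib

/-!
# ValiantsHypothesis / SymPencil — crux `EquivariantSdcNotQP` (stmt-ValiantsHypothesis-17792), line
# `birth_EquivariantSdcNotQP`, stub `stub_permify`: the Clifford-type dimension bound
# `2^N ≤ dim V` from `N` twisted-commuting pairs of operators

Helper of the item (`--supports stmt-ValiantsHypothesis-17792 --as helper`; 0 definitions, 0 named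
facts).  This is the linear-algebra half of the *spin dichotomy* for projective representations of
the symmetric groups (Schur 1911): if a projective representation of `𝔖_n` has anticommuting lifts
of disjoint transpositions, its degree is at least `2^{⌊n/4⌋}`.

* `mapsTo_maxGenEigenspace_of_twisted_comm` — if `f ∘ g = ω • (g ∘ f)` then `g` maps the maximal
  generalised eigenspace of `f` for `μ` into the one for `ω μ`.
* **`two_pow_le_finrank_of_twisted_pairs`** — over an algebraically closed field, `N` pairs
  `(X_i, Y_i)` of injective endomorphisms of a nonzero finite-dimensional space with the `X_i`
  pairwise commuting, `X_i Y_i = ω_i Y_i X_i` (`ω_i ≠ 1`) and `X_j Y_i = Y_i X_j` (`i ≠ j`) force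
  `2^N ≤ dim V`: the `Y_i` permute the simultaneous generalised eigenspaces of the `X_i`
  (Mathlib's `Module.End.independent_iInf_maxGenEigenspace_of_forall_mapsTo`,
  `iSup_iInf_maxGenEigenspace_eq_top_of_forall_mapsTo`), producing `2^N` distinct nonzero ones.
* **`two_pow_le_of_anticommuting_involutions`** — matrices `T_0, …, T_{n-2}` with `T_r² = 1` and
  `T_r T_t = - T_t T_r` for `|r - t| ≥ 2` exist in size `k ≥ 1` only if `2^{⌊n/4⌋} ≤ k`
  (`X_i = T_{4i} T_{4i+2}`, `Y_i = T_{4i}`); `le_log_of_anticommuting_involutions`: then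
  `n ≤ 4 (log₂ k + 1)`.

Honest framing: linear algebra only; `stub_permify`, the crux `SymPencil.EquivariantSdcNotQP` and
`VP ≠ VNP` remain OPEN and nothing here is progress on them.
-/

noncomputable section

set_option linter.dupNamespace false

namespace Summit.ValiantsHypothesis.ValiantsHypothesis.Theorems.SymPencilEquivariantSdcNotQP.SpinDichotomy

open Module Module.End Set

section Abstract

variable {K V : Type*} [Field K] [AddCommGroup V] [Module K V]

/-- **Twisted commutation moves generalised eigenspaces.**  If `f ∘ g = ω • (g ∘ f)` then `g` maps
the maximal generalised `μ`-eigenspace of `f` into the maximal generalised `ω μ`-eigenspace: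
`(f - ωμ)^k ∘ g = ω^k • g ∘ (f - μ)^k`. [folklore] -/
theorem mapsTo_maxGenEigenspace_of_twisted_comm (f g : End K V) (ω μ : K)
    (h : f * g = ω • (g * f)) :
    MapsTo g (f.maxGenEigenspace μ) (f.maxGenEigenspace (ω * μ)) := by
  have key : ∀ k : ℕ, (f - (ω * μ) • (1 : End K V)) ^ k * g =
      ω ^ k • (g * (f - μ • (1 : End K V)) ^ k) := by
    intro k
    induction k with
    | zero => rw [pow_zero, pow_zero, pow_zero, one_mul, mul_one, one_smul]
    | succ k ih =>
      have step : (f - (ω * μ) • (1 : End K V)) * g = ω • (g * (f - μ • (1 : End K V))) := by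
        rw [sub_mul, smul_mul_assoc, one_mul, h, mul_sub, smul_sub, mul_smul_comm, mul_one,
          mul_smul]
      rw [pow_succ, mul_assoc, step, mul_smul_comm, ← mul_assoc, ih, smul_mul_assoc, smul_smul,
        mul_assoc g, ← pow_succ, ← pow_succ']
  intro v hv
  rw [SetLike.mem_coe, mem_maxGenEigenspace] at hv ⊢
  obtain ⟨k, hk⟩ := hv
  refine ⟨k, ?_⟩
  have := LinearMap.congr_fun (key k) v
  rw [Module.End.mul_apply, LinearMap.smul_apply, Module.End.mul_apply, hk, map_zero,
    smul_zero] at this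
  exact this

/-- **`2^N ≤ dim V` from `N` twisted-commuting pairs** (the eigenvalue form of the Clifford /
extraspecial-group degree bound).  `X_i` pairwise commuting and injective, `Y_i` injective,
`X_i Y_i = ω_i Y_i X_i` with `ω_i ≠ 1`, `X_j Y_i = Y_i X_j` for `i ≠ j`; then the `2^N` simultaneous
generalised eigenspaces of the `X_i` obtained from a nonzero one by applying the `Y_i`, `i ∈ S`
(`S ⊆ {0,…,N-1}`), are nonzero and pairwise distinct, and independent subspaces are at most
`dim V` in number. [folklore] -/
theorem two_pow_le_finrank_of_twisted_pairs [IsAlgClosed K] [FiniteDimensional K V] [Nontrivial V]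
    {N : ℕ} (X Y : Fin N → End K V) (ω : Fin N → K)
    (hXX : ∀ i j, Commute (X i) (X j))
    (hX : ∀ i, Function.Injective (X i))
    (hY : ∀ i, Function.Injective (Y i))
    (hω : ∀ i, ω i ≠ 1)
    (hXY : ∀ i, X i * Y i = ω i • (Y i * X i))
    (hXY' : ∀ i j, i ≠ j → Commute (X j) (Y i)) :
    2 ^ N ≤ finrank K V := by
  classical
  -- the simultaneous generalised eigenspaces of the commuting family `X`
  set W : (Fin N → K) → Submodule K V := fun χ => ⨅ i, (X i).maxGenEigenspace (χ i) with hW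
  have hmaps : ∀ i j (φ : K), MapsTo (X i)
      ((X j).maxGenEigenspace φ : Set V) ((X j).maxGenEigenspace φ : Set V) :=
    fun i j φ => mapsTo_maxGenEigenspace_of_comm (hXX j i) φ
  have hind : iSupIndep W := independent_iInf_maxGenEigenspace_of_forall_mapsTo X hmaps
  have htop : ⨆ χ, W χ = ⊤ :=
    iSup_iInf_maxGenEigenspace_eq_top_of_forall_mapsTo X hmaps
      (fun i => iSup_maxGenEigenspace_eq_top (X i))
  -- one of them is nonzero
  obtain ⟨χ₀, hχ₀⟩ : ∃ χ, W χ ≠ ⊥ := by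
    by_contra! hall
    have hbot : (⨆ χ, W χ) = ⊥ := by
      rw [iSup_eq_bot]
      exact hall
    rw [htop] at hbot
    exact top_ne_bot hbot
  -- its eigenvalues are nonzero (the `X i` are injective)
  have hχ₀ne : ∀ i, χ₀ i ≠ 0 := by
    intro i hi
    apply hχ₀
    rw [eq_bot_iff]
    intro v hv
    have hv' := (Submodule.mem_iInf _).mp hv i
    rw [hi, mem_maxGenEigenspace] at hv'
    obtain ⟨k, hk⟩ := hv'
    rw [zero_smul, sub_zero] at hk
    have hinj : Function.Injective ((X i) ^ k) := by
      rw [Module.End.coe_pow]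
      exact Function.Injective.iterate (hX i) k
    rw [Submodule.mem_bot]
    exact hinj (by rw [hk, map_zero])
  -- `Y i` moves `W χ` into `W (χ with χ i replaced by ω i * χ i)`
  have hmove : ∀ (i : Fin N) (χ : Fin N → K) (v : V), v ∈ W χ →
      Y i v ∈ W (Function.update χ i (ω i * χ i)) := by
    intro i χ v hv
    rw [hW, Submodule.mem_iInf] at hv ⊢
    intro j
    by_cases hji : j = i
    · subst hji
      rw [Function.update_self]
      exact mapsTo_maxGenEigenspace_of_twisted_comm (X j) (Y j) (ω j) (χ j) (hXY j) (hv j)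
    · rw [Function.update_of_ne hji]
      exact mapsTo_maxGenEigenspace_of_comm (hXY' i j (Ne.symm hji)) (χ j) (hv j)
  -- the twisted characters `χ_S`, `S ⊆ Fin N`
  set tw : Finset (Fin N) → (Fin N → K) := fun S i => if i ∈ S then ω i * χ₀ i else χ₀ i with htw
  have htw_inj : Function.Injective tw := by
    intro S T hST
    ext i
    have h := congr_fun hST i
    simp only [htw] at h
    have hne : ω i * χ₀ i ≠ χ₀ i := by
      intro e
      exact hω i (mul_left_eq_self₀.mp e |>.resolve_right (hχ₀ne i))
    by_cases hS : i ∈ S <;> by_cases hT : i ∈ T <;> simp only [hS, hT, if_true, if_false] at h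
    · exact iff_of_true hS hT
    · exact absurd h hne
    · exact absurd h.symm hne
    · exact iff_of_false hS hT
  -- all `W (tw S)` are nonzero
  have hne : ∀ S : Finset (Fin N), W (tw S) ≠ ⊥ := by
    intro S
    induction S using Finset.induction_on with
    | empty =>
      have : tw ∅ = χ₀ := by
        ext i; simp only [htw, Finset.notMem_empty, if_false]
      rw [this]; exact hχ₀
    | insert i S hi ih =>
      obtain ⟨v, hv, hv0⟩ := Submodule.exists_mem_ne_zero_of_ne_bot ih
      have hup : Function.update (tw S) i (ω i * tw S i) = tw (insert i S) := by
        ext j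
        by_cases hji : j = i
        · subst hji
          rw [Function.update_self]
          simp only [htw, Finset.mem_insert_self, if_true, hi, if_false]
        · rw [Function.update_of_ne hji]
          simp only [htw, Finset.mem_insert, hji, false_or]
      have h1 : Y i v ∈ W (tw (insert i S)) := hup ▸ hmove i (tw S) v hv
      intro hbot
      rw [hbot, Submodule.mem_bot] at h1
      exact hv0 (hY i (by rw [h1, map_zero]))
  -- counting the nonzero members of an independent family
  haveI : Fintype {χ // W χ ≠ ⊥} := hind.fintypeNeBotOfFiniteDimensional
  calc 2 ^ N = Fintype.card (Finset (Fin N)) := by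
        rw [Fintype.card_finset, Fintype.card_fin]
    _ ≤ Fintype.card {χ // W χ ≠ ⊥} :=
        Fintype.card_le_of_injective (fun S => ⟨tw S, hne S⟩)
          (fun S T h => htw_inj (congrArg Subtype.val h))
    _ ≤ finrank K V := hind.subtype_ne_bot_le_finrank

end Abstract

/-! ## Anticommuting involutions `T_0, …, T_{n-2}` in `GL_k(ℂ)` -/

section Involutions

open Matrix

variable {k n : ℕ} (T : ℕ → Matrix (Fin k) (Fin k) ℂ)

/-- Far-apart generators anticommute in both orders. [folklore] -/
theorem anticomm_symm
    (hanti : ∀ r t, t + 1 < n → r + 2 ≤ t → T r * T t = -(T t * T r))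
    {a c : ℕ} (ha : a + 1 < n) (hc : c + 1 < n) (hfar : a + 2 ≤ c ∨ c + 2 ≤ a) :
    T a * T c = -(T c * T a) := by
  rcases hfar with h | h
  · exact hanti a c hc h
  · rw [hanti c a ha h, neg_neg]

/-- A product of two generators commutes past a generator far from both. [folklore] -/
theorem pair_mul_comm
    (hanti : ∀ r t, t + 1 < n → r + 2 ≤ t → T r * T t = -(T t * T r))
    {a b c : ℕ} (ha : a + 1 < n) (hb : b + 1 < n) (hc : c + 1 < n)
    (hac : a + 2 ≤ c ∨ c + 2 ≤ a) (hbc : b + 2 ≤ c ∨ c + 2 ≤ b) :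
    T a * T b * T c = T c * (T a * T b) := by
  rw [Matrix.mul_assoc, anticomm_symm T hanti hb hc hbc, Matrix.mul_neg, ← Matrix.mul_assoc,
    anticomm_symm T hanti ha hc hac, Matrix.neg_mul, neg_neg, Matrix.mul_assoc]

/-- **Anticommuting involutions force `2^{⌊n/4⌋} ≤ k`.**  If `T_0, …, T_{n-2} ∈ M_k(ℂ)`, `k ≥ 1`,
satisfy `T_r² = 1` and `T_r T_t = -T_t T_r` for `r + 2 ≤ t`, then `2^{⌊n/4⌋} ≤ k`: apply
`two_pow_le_finrank_of_twisted_pairs` to `X_i = T_{4i} T_{4i+2}`, `Y_i = T_{4i}` (`i < ⌊n/4⌋`),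
for which `X_i Y_i = -Y_i X_i` and everything else commutes.  This is the degree bound for the
spin representations of `𝔖_n` in its crudest form (Schur 1911: the exact minimum is
`2^{⌊(n-1)/2⌋}` for the basic spin representation). [folklore] -/
theorem two_pow_le_of_anticommuting_involutions (hk : 1 ≤ k)
    (hsq : ∀ r, r + 1 < n → T r * T r = 1)
    (hanti : ∀ r t, t + 1 < n → r + 2 ≤ t → T r * T t = -(T t * T r)) :
    2 ^ (n / 4) ≤ k := by
  haveI : Nonempty (Fin k) := ⟨⟨0, hk⟩⟩
  set N := n / 4 with hN
  -- indices
  have hidx : ∀ i : Fin N, 4 * (i : ℕ) + 2 + 1 < n := by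
    intro i; have := i.2; omega
  have hidx' : ∀ i : Fin N, 4 * (i : ℕ) + 1 < n := by
    intro i; have := i.2; omega
  set X : Fin N → End ℂ (Fin k → ℂ) := fun i => toLin' (T (4 * i) * T (4 * i + 2)) with hX
  set Y : Fin N → End ℂ (Fin k → ℂ) := fun i => toLin' (T (4 * i)) with hY
  have key := two_pow_le_finrank_of_twisted_pairs (K := ℂ) X Y (fun _ => (-1 : ℂ)) ?_ ?_ ?_ ?_ ?_ ?_
  · rwa [Module.finrank_fin_fun] at key
  · -- `X i` and `X j` commute
    intro i j
    by_cases hij : i = j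
    · subst hij; exact Commute.refl _
    have hij' : (i : ℕ) ≠ j := fun e => hij (Fin.ext e)
    change X i * X j = X j * X i
    simp only [hX]
    rw [Module.End.mul_eq_comp, Module.End.mul_eq_comp, ← toLin'_mul, ← toLin'_mul]
    congr 1
    rw [← Matrix.mul_assoc, pair_mul_comm T hanti (hidx' i) (hidx i) (hidx' j) (by omega) (by omega),
      Matrix.mul_assoc, pair_mul_comm T hanti (hidx' i) (hidx i) (hidx j) (by omega) (by omega),
      ← Matrix.mul_assoc]
  · -- `X i` injective
    intro i
    have hl : Function.LeftInverse (toLin' (T (4 * i + 2) * T (4 * i))) (X i) := by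
      intro v
      change (toLin' (T (4 * ↑i + 2) * T (4 * ↑i))) ((toLin' (T (4 * ↑i) * T (4 * ↑i + 2))) v) = v
      rw [← LinearMap.comp_apply, ← toLin'_mul, Matrix.mul_assoc, ← Matrix.mul_assoc (T (4 * i)),
        hsq _ (hidx' i), Matrix.one_mul, hsq _ (hidx i), toLin'_one, LinearMap.id_apply]
    exact hl.injective
  · -- `Y i` injective
    intro i
    have hl : Function.LeftInverse (toLin' (T (4 * i))) (Y i) := by
      intro v
      change (toLin' (T (4 * ↑i))) ((toLin' (T (4 * ↑i))) v) = v
      rw [← LinearMap.comp_apply, ← toLin'_mul, hsq _ (hidx' i), toLin'_one, LinearMap.id_apply]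
    exact hl.injective
  · intro i; norm_num
  · -- `X i * Y i = - (Y i * X i)`
    intro i
    change X i * Y i = (-1 : ℂ) • (Y i * X i)
    refine (?_ : X i * Y i = -(Y i * X i)).trans (neg_one_smul ℂ _).symm
    simp only [hX, hY]
    rw [Module.End.mul_eq_comp, Module.End.mul_eq_comp, ← toLin'_mul, ← toLin'_mul, ← map_neg]
    congr 1
    rw [Matrix.mul_assoc, anticomm_symm T hanti (hidx i) (hidx' i) (Or.inr (by omega)), Matrix.mul_neg]
  · -- `X j` commutes with `Y i` for `i ≠ j`
    intro i j hij
    have hij' : (i : ℕ) ≠ j := fun e => hij (Fin.ext e)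
    change X j * Y i = Y i * X j
    simp only [hX, hY]
    rw [Module.End.mul_eq_comp, Module.End.mul_eq_comp, ← toLin'_mul, ← toLin'_mul]
    congr 1
    exact pair_mul_comm T hanti (hidx' j) (hidx j) (hidx' i) (by omega) (by omega)

/-- Logarithmic form: anticommuting involutions `T_0, …, T_{n-2}` in `M_k(ℂ)`, `k ≥ 1`, force
`n ≤ 4 (log₂ k + 1)`. [folklore] -/
theorem le_log_of_anticommuting_involutions (hk : 1 ≤ k)
    (hsq : ∀ r, r + 1 < n → T r * T r = 1)
    (hanti : ∀ r t, t + 1 < n → r + 2 ≤ t → T r * T t = -(T t * T r)) :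
    n ≤ 4 * (Nat.log 2 k + 1) := by
  have h := two_pow_le_of_anticommuting_involutions T hk hsq hanti
  have hlog : n / 4 ≤ Nat.log 2 k := Nat.le_log_of_pow_le (by norm_num) h
  omega

end Involutions

end Summit.ValiantsHypothesis.ValiantsHypothesis.Theorems.SymPencilEquivariantSdcNotQP.SpinDichotomy

end
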